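import Literature.MathematicalPhysics.QuantumFieldTheory.Balaban1983to89.B9Eq387IMSAssemblyRows
import Literature.MathematicalPhysics.QuantumFieldTheory.Balaban1983to89.B9Eq387IMSLocalLettersLattice
import Literature.MathematicalPhysics.QuantumFieldTheory.Balaban1983to89.B9Eq387IMSAveragingLettersBackground

/-!
# `Balaban1983to89.B9Eq387IMSAssemblyLattice` — T. Bałaban, *Propagators for lattice gauge theories in a background field*, Commun. Math. Phys. **99**
# (1985) 389–434 [Balaban1985BackgroundPropagators] p. 408 «Σ_□ h²_□ = 1», (3.87)–(3.89) p. 409, (3.100)–(3.104) pp. 413–414, (3.26) p. 395: **KERNEL 7 AT THE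
# LATTICE — the instance theorem of ledger row L11: for the tree's partition `{h_z}` (scale `M₀`), the local letters `T₁ = D_U` (covariant curl), `T₂ = D*_U`
# (covariant divergence) at `c = η⁻¹` and `T₃ = √a·Q(U)` (one-step vector averaging), and ANY non-local letter `W` with a displayed (up) row `b_W`, local
# strong coercivity (loc) on the cubes gives GLOBAL strong coercivity
# `γ₁(‖D_UA‖² + ‖D*_UA‖² + a‖Q(U)A‖²) + (γ₀ − b_W − (1 − γ₁)(b₁ + b₂ + a·b₃))‖A‖² ≤ ‖D_UA‖² + ‖D*_UA‖² + a‖Q(U)A‖² − ‖WA‖²`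
# with the rows `b₁`, `b₂` ((D) §4, `η`-free), `b₃` ((E), small background) BY NAME** — route R2′ STEP B8′ S-P7 of the pub-balaban NE9 chain

statement-level skeleton of published theorems with citation tags; proofs where landed; nothing here is a claim about the Yang–Mills mass gap

CITATION HEADER (lean-in-tree rule).  Audit cell `pub-balaban`, sub-cell `t4`, BINDER row NE9; filed by NE9 formalisation-swarm LEAF PROVER 01
(`b2b-balaban-t4-ne9-formalise-leaf-01`, gen 83), the lineage of the socket (F) `B9Eq387IMSAssemblyRows.ims_assembly_strong_of_rows` (gen 82; kernel 7 of
t4-ne9-idea-1 gen 92 ported by gen 80 as `B9Eq387IMSAssembly`), of the rows (D) `B9Eq387IMSLocalLettersLattice` §4 (`T₁`, `T₂` for `B5SmoothPartition.hS`,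
ne9-leaf-04's `η`-free Leibniz letters), (E) `B9Eq387IMSAveragingLettersBackground.sum_norm_sq_QtorusW_localised_le_smooth` (`T₃ = Q(U)`, ne9-leaf-02's
`θ_Q`-letter) and of row L9's `b_W` (`B9Eq349KWAssembly`, this gen — entered here as a DISPLAYED row so that this file does not wait on it).  Source READ in the
held text [Balaban1985BackgroundPropagators] (journal page = PDF page + 388): p. 408 *«We take the partition of unity {h_□} … Σ_{□∈𝒟} h²_□ = 1»*, p. 409
(3.87)–(3.89) (the localised operators), p. 414 l.1–3 *«They are of the order O(M⁻¹), or O(M⁻²), if considered on a proper scale»*, p. 395 (3.26).  Print localises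
by parametrices and random walks; the IMS assembly is the ROUTE's device (ROUTES-NE9 §L1.2 R2′ STEP B8′ S-P7, ledger rows L0–L11); NOTHING of [B9] is asserted.

WHY (row L11).  The ledger's instance theorem is «the conjunction of the table's cells»: rows L3∕L4∕L6∕L7 for `i = 1, 2` = (D) §4, row L5–L7 for `i = 3` = (E)
scaled by `√a` ((F) `row_smul`), row L8∕L9 = the (up) row of `W` (displayed: `B9Eq349KWAssembly.norm_sq_adjoint_le_sum_localised` ∕ `exists_kW_DP` produce it
for `W = (D_UP(U))†`), row L10 = (loc) (displayed: Tier P ∕ S-P6′ ∕ B7′-1), row L1 = `Σ_z ‖χ_B^zA‖² = ‖A‖²` ((C)+(D) §1).  The three local letters land in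
DIFFERENT spaces (plaquettes, sites, coarse bonds); kernel 7 is norm-only, so they are fed as the REAL family `i ↦ ‖T_iA‖` (`E_i := ℝ`).

WHAT IS PROVED (sorry-free; proof lane — no `def`; [folklore] bookkeeping BY NAME).
* `sum_norm_sq_chiB_apply` — row L1: `Σ_z ‖χ_B^zA‖² = ‖A‖²` for the bond multipliers of `hS` ((D) §1 + (C) `sum_norm_sq_chi_apply`).
* **`ims_assembly_strong_lattice`** — THE INSTANCE THEOREM displayed above: hypotheses = the structure letters of (D) §4 (`η > 0`, transports `‖R(b)v‖, ‖S(b)v‖ ≤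
  M_T‖v‖`) and of (E) (`Q(U)`'s `hL, hα1, hU1, hreg`, `φ` with `M_φ, M_φ′`, bond window `ε_U`), the partition data (`1 ≤ M₀`, `M₀ ∣ Lm_i`, `2M₀ ≤ Lm_i`) with its
  four samplings (bonds at `b₋`, plaquettes at the base site, sites, coarse bonds at the block corner), `0 ≤ a`, the (up) row of `W` and (loc); conclusion with
  `b₁ = (16d(1+M_T)M_T + 8dM_T²)·64∕(M₀η)²`, `b₂ = (2d(1+M_T)M_T + dM_T²)·64∕(M₀η)²`, `b₃` = (E)'s displayed constant.
* `ims_assembly_lattice` — the plain case `γ₁ = 0`.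
HONEST SCOPE.  Assembly only; `b_W` and (loc) are LETTERS here (rows L8–L10's files supply them); `M₀η = M` physical; no number evaluated; the mass constant
`γ₀ − b_W − (1−γ₁)Σb_i ≥ γ₀∕2` needs `M` large AND `ε_U` small against `γ₀∕a` — the `i = 3` row is realised PERTURBATIVELY through (E)'s `θ_Q`-letter
(`Q(U) = Q(1) + E′`, `‖E′‖ ≤ θ_Q ∝ ε_U`), whose `θ_Q`-terms are `M₀`-flat (t4-ne9-idea-1 g100's located note N-idea1-g100-1, journal 2026-08-23 l.51476; the
exact-Leibniz `ad_jQ̃′` rows L6∕L7 of the ledger remain the `ε_U`-free alternative); the size of the window is the ledger's NEEDS-CONSTANT (KAPPA1 OPEN), not addressed.  NOT NE9 (cell pub-balaban: NE9 NOT PRINTED ∕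
NOT PROVED; «NE9 ⇐ the named binders»; row WALLED ON A MODEL (O-NE9-1; #5 UNRULED); spine PROVED 0∕9; rung (B)+1 on a finite T⁴ — NOT infinite volume, NOT mass
gap, NOT Clay; HONEST DEPENDENCY: continuum YM on T⁴ ⇐ BetaPertH ∧ nine spine estimates (0/9 proved); BetaPertH ⇐ (D1) ∧ (D4) ∧ CAP+tail; G-an2-4 gates asym,
D1 and NE2/3/4).  NEW file importing (F), (D), (E); nothing modified.  Net new unproved facts: 0.
-/

noncomputable section

set_option autoImplicit false

open scoped BigOperators InnerProductSpace ComplexConjugate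

namespace Literature.MathematicalPhysics.QuantumFieldTheory.Balaban1983to89.B9Eq387IMSAssemblyLattice

open B4Sect5Torus (TSite)
open B5TorusCover (Ctr)
open B5SmoothPartition (hS sum_hS_sq)
open B7Prop1Explicit (U1 Wcx boxVec)
open B9SectCLatticeCarrier (Bond bpos btgt)
open B9Eq311L2Pairing (WL2)
open B9Eq319QprimeTorus (fineP)
open B11Eq103H1Complex (SiteL2K BondL2K covDivL2K)
open B9Eq310HessianOperator (PlaqL2K covCurlL2K)
open B9Eq315QTorus (perSite perCfg cornerSite QtorusW)
open B9Eq387QuadraticPartitionIMS (sum_norm_sq_chi_apply)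
open B9Eq387IMSLocalLettersLattice (sum_comp_self_eq_one_of_pointwise inner_apply_eq_inner_apply_of_pointwise sum_norm_sq_covCurl_localised_le_smooth
  sum_norm_sq_covDiv_localised_le_smooth)
open B9Eq387IMSAveragingLettersBackground (sum_norm_sq_QtorusW_localised_le_smooth)
open B9Eq387IMSAssemblyRows (ims_assembly_strong_of_rows row_smul)

variable {d : ℕ} (L : ℕ) (m : Fin d → ℕ) [∀ i, NeZero (fineP L m i)] (hL : 1 ≤ L)
  {𝔸 : Type*} [NormedRing 𝔸] [NormOneClass 𝔸] [NormedAlgebra ℂ 𝔸] [CompleteSpace 𝔸]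
  (U : Bond d (fineP L m) → 𝔸ˣ) {α : ℝ} (hα1 : α ≤ 1 / 64)
  (hU1 : ∀ (x : B7Prop1Explicit.Site d) (κ : Fin d), perCfg (fineP L m) U x κ ∈ U1 𝔸)
  (hreg : ∀ (y : TSite d m) (κ : Fin d) (r : Fin d → Fin L),
    ‖((Wcx L (perCfg (fineP L m) U) (cornerSite L y) κ (boxVec L r) : 𝔸ˣ) : 𝔸) - 1‖ ≤ α)
  {W : Type*} [NormedAddCommGroup W] [InnerProductSpace ℂ W] [FiniteDimensional ℂ W] (φ : W ≃ₗ[ℂ] 𝔸) {c₀ c₁ : ℝ} [Fact (0 < c₀)] [Fact (0 < c₁)]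
  {εU : ℝ} (hεU : 0 ≤ εU) (hUε : ∀ b : Bond d (fineP L m), ‖(U b : 𝔸) - 1‖ ≤ εU)
  {Mφ Mφ' : ℝ} (hMφ : 0 ≤ Mφ) (hφ : ∀ w, ‖φ w‖ ≤ Mφ * ‖w‖) (hMφ' : 0 ≤ Mφ') (hφ' : ∀ X, ‖φ.symm X‖ ≤ Mφ' * ‖X‖)
  -- the partition and its four samplings
  {M₀ : ℕ} (hM : 1 ≤ M₀) (hdiv : ∀ i, M₀ ∣ fineP L m i) (h2N : ∀ i, 2 * M₀ ≤ fineP L m i)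
  (χB : Ctr (fineP L m) M₀ → BondL2K ℂ d (fineP L m) c₀ W →L[ℂ] BondL2K ℂ d (fineP L m) c₀ W)
  (χP : Ctr (fineP L m) M₀ → PlaqL2K ℂ d (fineP L m) c₀ W →L[ℂ] PlaqL2K ℂ d (fineP L m) c₀ W)
  (χ0 : Ctr (fineP L m) M₀ → SiteL2K ℂ d (fineP L m) c₀ W →L[ℂ] SiteL2K ℂ d (fineP L m) c₀ W)
  (χC : Ctr (fineP L m) M₀ → BondL2K ℂ d m c₁ W →L[ℂ] BondL2K ℂ d m c₁ W)
  (hχB : ∀ z (A : BondL2K ℂ d (fineP L m) c₀ W) (b : Bond d (fineP L m)),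
    WL2.equiv ℂ _ W (χB z A) b = (hS (fineP L m) M₀ z (bpos b) : ℂ) • WL2.equiv ℂ _ W A b)
  (hχP : ∀ z (G : PlaqL2K ℂ d (fineP L m) c₀ W) (p : B9SectCLatticeCarrier.Plaq d (fineP L m)),
    WL2.equiv ℂ _ W (χP z G) p = (hS (fineP L m) M₀ z p.1 : ℂ) • WL2.equiv ℂ _ W G p)
  (hχ0 : ∀ z (f : SiteL2K ℂ d (fineP L m) c₀ W) (y : TSite d (fineP L m)),
    WL2.equiv ℂ _ W (χ0 z f) y = (hS (fineP L m) M₀ z y : ℂ) • WL2.equiv ℂ _ W f y)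
  (hχC : ∀ z (g : BondL2K ℂ d m c₁ W) (c : Bond d m),
    WL2.equiv ℂ _ W (χC z g) c = (hS (fineP L m) M₀ z (perSite (fineP L m) (cornerSite L c.1)) : ℂ) • WL2.equiv ℂ _ W g c)
  -- the transports of the local letters and the lattice spacing
  {R S : Bond d (fineP L m) → W →ₗ[ℂ] W} {MT η : ℝ} (hη : 0 < η) (hMT : 0 ≤ MT) (hR : ∀ b v, ‖R b v‖ ≤ MT * ‖v‖) (hS' : ∀ b v, ‖S b v‖ ≤ MT * ‖v‖)

omit [∀ i, NeZero (fineP L m i)] [FiniteDimensional ℂ W] in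
include hχB hM hdiv h2N in
/-- **ROW L1: `Σ_z ‖χ_B^zA‖² = ‖A‖²`** for the bond multipliers of the tree's partition (`Σ_z h_z² = 1`). [folklore]
[cite: Balaban1985BackgroundPropagators, p.408 «Σ h²_□ = 1»; Balaban1984PropagatorsI, (1.118) p.36] -/
theorem sum_norm_sq_chiB_apply (A : BondL2K ℂ d (fineP L m) c₀ W) : ∑ z : Ctr (fineP L m) M₀, ‖χB z A‖ ^ 2 = ‖A‖ ^ 2 := by
  have h1 := sum_comp_self_eq_one_of_pointwise (𝕜 := ℂ) Finset.univ bpos (hS (fineP L m) M₀) χB hχB (fun x => sum_hS_sq hM hdiv h2N x)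
  have hE : ∀ A : BondL2K ℂ d (fineP L m) c₀ W, ∑ z : Ctr (fineP L m) M₀, χB z (χB z A) = A := fun A => by
    have h := DFunLike.congr_fun h1 A
    simpa using h
  exact sum_norm_sq_chi_apply Finset.univ χB hE (fun z y y' => inner_apply_eq_inner_apply_of_pointwise bpos (χB z) (hS (fineP L m) M₀ z) (hχB z) y y') A

include hχB hχP hχ0 hχC hεU hUε hMφ hφ hMφ' hφ' hMT hR hS' hM hdiv h2N hη in
/-- **KERNEL 7 AT THE LATTICE — THE INSTANCE THEOREM OF ROW L11.**  Local letters `T₁ = D_U` (curl, transports `R`), `T₂ = D*_U` (divergence, transports `S`) at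
`c = η⁻¹`, `T₃ = √a·Q(U)`; the tree's partition `{h_z}`; ANY non-local `W : L²(bonds) → F` with a displayed (up) row `‖WA‖² ≤ Σ_z ‖W(χ_B^zA)‖² + b_W‖A‖²`; local strong
coercivity (loc) on every cube ⟹
`γ₁(‖D_UA‖² + ‖D*_UA‖² + ‖√a·Q(U)A‖²) + (γ₀ − b_W − (1 − γ₁)(b₁ + b₂ + a·b₃))‖A‖² ≤ ‖D_UA‖² + ‖D*_UA‖² + ‖√a·Q(U)A‖² − ‖WA‖²`, with the `η`-FREE rows
`b₁ = (16d(1+M_T)M_T + 8dM_T²)·64∕(M₀η)²`, `b₂ = (2d(1+M_T)M_T + dM_T²)·64∕(M₀η)²` ((D) §4) and (E)'s `b₃` — (F) `ims_assembly_strong_of_rows` on the real family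
`i ↦ ‖T_iA‖`. [folklore] (IMS localisation bookkeeping) [cite: Balaban1985BackgroundPropagators, p.408 «Σ h²_□ = 1», (3.87)–(3.89) p.409, (3.100)–(3.104) pp.413–414, (3.26) p.395] -/
theorem ims_assembly_strong_lattice {a : ℝ} (ha : 0 ≤ a) {F : Type*} [NormedAddCommGroup F] (Wop : BondL2K ℂ d (fineP L m) c₀ W → F) {bW γ₁ γ₀ : ℝ}
    (hWrow : ∀ A, ‖Wop A‖ ^ 2 ≤ ∑ z : Ctr (fineP L m) M₀, ‖Wop (χB z A)‖ ^ 2 + bW * ‖A‖ ^ 2) (hγ₁ : γ₁ ≤ 1)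
    (hloc : ∀ (z : Ctr (fineP L m) M₀) (A : BondL2K ℂ d (fineP L m) c₀ W),
      γ₁ * (‖covCurlL2K ℂ c₀ ((η : ℂ))⁻¹ R (χB z A)‖ ^ 2 + ‖covDivL2K ℂ c₀ ((η : ℂ))⁻¹ S (χB z A)‖ ^ 2 +
          ‖((Real.sqrt a : ℝ) : ℂ) • QtorusW L m hL φ U hα1 hU1 hreg (c₁ := c₁) (χB z A)‖ ^ 2) + γ₀ * ‖χB z A‖ ^ 2 ≤
        (‖covCurlL2K ℂ c₀ ((η : ℂ))⁻¹ R (χB z A)‖ ^ 2 + ‖covDivL2K ℂ c₀ ((η : ℂ))⁻¹ S (χB z A)‖ ^ 2 +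
          ‖((Real.sqrt a : ℝ) : ℂ) • QtorusW L m hL φ U hα1 hU1 hreg (c₁ := c₁) (χB z A)‖ ^ 2) - ‖Wop (χB z A)‖ ^ 2)
    (A : BondL2K ℂ d (fineP L m) c₀ W) :
    γ₁ * (‖covCurlL2K ℂ c₀ ((η : ℂ))⁻¹ R A‖ ^ 2 + ‖covDivL2K ℂ c₀ ((η : ℂ))⁻¹ S A‖ ^ 2 +
          ‖((Real.sqrt a : ℝ) : ℂ) • QtorusW L m hL φ U hα1 hU1 hreg (c₁ := c₁) A‖ ^ 2) +
        (γ₀ - bW - (1 - γ₁) *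
          ((16 * d * ((1 + MT) * MT * (64 * ((M₀ : ℝ) * η)⁻¹ ^ 2)) + 8 * d * MT ^ 2 * (64 * ((M₀ : ℝ) * η)⁻¹ ^ 2)) +
            (2 * d * ((1 + MT) * MT * (64 * ((M₀ : ℝ) * η)⁻¹ ^ 2)) + d * MT ^ 2 * (64 * ((M₀ : ℝ) * η)⁻¹ ^ 2)) +
            a * ((Real.sqrt (c₁ / (c₀ * (L : ℝ) ^ d)) + Mφ' * Mφ * Real.sqrt (2 * d * c₁ / c₀) * (102 * (d + 1) ^ 2 * L * εU)) *
                (256 * d * ((L : ℝ) - 1) ^ 2 / (M₀ : ℝ) ^ 2 * Real.sqrt (c₁ / (c₀ * (L : ℝ) ^ d)) +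
                  4 * (Mφ' * Mφ * Real.sqrt (2 * d * c₁ / c₀) * (102 * (d + 1) ^ 2 * L * εU))) +
              (2 * (256 * d * ((L : ℝ) - 1) ^ 2 / (M₀ : ℝ) ^ 2 * (c₁ / (c₀ * (L : ℝ) ^ d))) +
                8 * (Mφ' * Mφ * Real.sqrt (2 * d * c₁ / c₀) * (102 * (d + 1) ^ 2 * L * εU)) ^ 2)))) * ‖A‖ ^ 2 ≤
      (‖covCurlL2K ℂ c₀ ((η : ℂ))⁻¹ R A‖ ^ 2 + ‖covDivL2K ℂ c₀ ((η : ℂ))⁻¹ S A‖ ^ 2 +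
          ‖((Real.sqrt a : ℝ) : ℂ) • QtorusW L m hL φ U hα1 hU1 hreg (c₁ := c₁) A‖ ^ 2) - ‖Wop A‖ ^ 2 := by
  -- the three rows by name
  have h1 := fun A => sum_norm_sq_covCurl_localised_le_smooth (𝕜 := ℂ) (c₀ := c₀) (R := R) hM hdiv h2N hη hMT hR χB χP hχB hχP A
  have h2 := fun A => sum_norm_sq_covDiv_localised_le_smooth (𝕜 := ℂ) (c₀ := c₀) (S := S) hM hdiv h2N hη hMT hS' χB χ0 hχB hχ0 A
  have h3 := fun A => row_smul Finset.univ (fun z A => χB z A) (fun A => QtorusW L m hL φ U hα1 hU1 hreg (c₁ := c₁) A) ((Real.sqrt a : ℝ) : ℂ)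
    (sum_norm_sq_QtorusW_localised_le_smooth L m hL U hα1 hU1 hreg φ hεU hUε hMφ hφ hMφ' hφ' hM hdiv h2N χB χC hχB hχC) A
  have hsa : ‖((Real.sqrt a : ℝ) : ℂ)‖ ^ 2 = a := by rw [Complex.norm_real, Real.norm_eq_abs, abs_of_nonneg (Real.sqrt_nonneg _), Real.sq_sqrt ha]
  simp only [hsa] at h3
  -- the real family `i ↦ ‖T_iA‖` and the socket
  have key := ims_assembly_strong_of_rows (ι := Fin 3) (E := fun _ => ℝ) Finset.univ (fun z A => χB z A)
    (fun i A => (![‖covCurlL2K ℂ c₀ ((η : ℂ))⁻¹ R A‖, ‖covDivL2K ℂ c₀ ((η : ℂ))⁻¹ S A‖,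
      ‖((Real.sqrt a : ℝ) : ℂ) • QtorusW L m hL φ U hα1 hU1 hreg (c₁ := c₁) A‖] : Fin 3 → ℝ) i) Wop
    (b := ![(16 * d * ((1 + MT) * MT * (64 * ((M₀ : ℝ) * η)⁻¹ ^ 2)) + 8 * d * MT ^ 2 * (64 * ((M₀ : ℝ) * η)⁻¹ ^ 2)),
      (2 * d * ((1 + MT) * MT * (64 * ((M₀ : ℝ) * η)⁻¹ ^ 2)) + d * MT ^ 2 * (64 * ((M₀ : ℝ) * η)⁻¹ ^ 2)),
      a * ((Real.sqrt (c₁ / (c₀ * (L : ℝ) ^ d)) + Mφ' * Mφ * Real.sqrt (2 * d * c₁ / c₀) * (102 * (d + 1) ^ 2 * L * εU)) *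
          (256 * d * ((L : ℝ) - 1) ^ 2 / (M₀ : ℝ) ^ 2 * Real.sqrt (c₁ / (c₀ * (L : ℝ) ^ d)) +
            4 * (Mφ' * Mφ * Real.sqrt (2 * d * c₁ / c₀) * (102 * (d + 1) ^ 2 * L * εU))) +
        (2 * (256 * d * ((L : ℝ) - 1) ^ 2 / (M₀ : ℝ) ^ 2 * (c₁ / (c₀ * (L : ℝ) ^ d))) +
          8 * (Mφ' * Mφ * Real.sqrt (2 * d * c₁ / c₀) * (102 * (d + 1) ^ 2 * L * εU)) ^ 2))])
    (bW := bW) (γ₁ := γ₁) (γ₀ := γ₀) (sum_norm_sq_chiB_apply L m hM hdiv h2N χB hχB)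
    (fun i A => by
      fin_cases i
      · simpa [Real.norm_eq_abs, abs_norm] using h1 A
      · simpa [Real.norm_eq_abs, abs_norm] using h2 A
      · simpa [Real.norm_eq_abs, abs_norm] using h3 A)
    hWrow hγ₁
    (fun z _ A => by simpa [Fin.sum_univ_three, Real.norm_eq_abs, abs_norm] using hloc z A) A
  simpa [Fin.sum_univ_three, Real.norm_eq_abs, abs_norm] using key

include hχB hχP hχ0 hχC hεU hUε hMφ hφ hMφ' hφ' hMT hR hS' hM hdiv h2N hη in
/-- **THE PLAIN CASE `γ₁ = 0`**: `(γ₀ − b_W − (b₁ + b₂ + a·b₃))‖A‖² ≤ ‖D_UA‖² + ‖D*_UA‖² + ‖√a·Q(U)A‖² − ‖WA‖²`. [folklore] (IMS localisation bookkeeping)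
[cite: Balaban1985BackgroundPropagators, p.408, (3.87)–(3.89) p.409, (3.26) p.395] -/
theorem ims_assembly_lattice {a : ℝ} (ha : 0 ≤ a) {F : Type*} [NormedAddCommGroup F] (Wop : BondL2K ℂ d (fineP L m) c₀ W → F) {bW γ₀ : ℝ}
    (hWrow : ∀ A, ‖Wop A‖ ^ 2 ≤ ∑ z : Ctr (fineP L m) M₀, ‖Wop (χB z A)‖ ^ 2 + bW * ‖A‖ ^ 2)
    (hloc : ∀ (z : Ctr (fineP L m) M₀) (A : BondL2K ℂ d (fineP L m) c₀ W),
      γ₀ * ‖χB z A‖ ^ 2 ≤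
        (‖covCurlL2K ℂ c₀ ((η : ℂ))⁻¹ R (χB z A)‖ ^ 2 + ‖covDivL2K ℂ c₀ ((η : ℂ))⁻¹ S (χB z A)‖ ^ 2 +
          ‖((Real.sqrt a : ℝ) : ℂ) • QtorusW L m hL φ U hα1 hU1 hreg (c₁ := c₁) (χB z A)‖ ^ 2) - ‖Wop (χB z A)‖ ^ 2)
    (A : BondL2K ℂ d (fineP L m) c₀ W) :
    (γ₀ - bW -
          ((16 * d * ((1 + MT) * MT * (64 * ((M₀ : ℝ) * η)⁻¹ ^ 2)) + 8 * d * MT ^ 2 * (64 * ((M₀ : ℝ) * η)⁻¹ ^ 2)) +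
            (2 * d * ((1 + MT) * MT * (64 * ((M₀ : ℝ) * η)⁻¹ ^ 2)) + d * MT ^ 2 * (64 * ((M₀ : ℝ) * η)⁻¹ ^ 2)) +
            a * ((Real.sqrt (c₁ / (c₀ * (L : ℝ) ^ d)) + Mφ' * Mφ * Real.sqrt (2 * d * c₁ / c₀) * (102 * (d + 1) ^ 2 * L * εU)) *
                (256 * d * ((L : ℝ) - 1) ^ 2 / (M₀ : ℝ) ^ 2 * Real.sqrt (c₁ / (c₀ * (L : ℝ) ^ d)) +
                  4 * (Mφ' * Mφ * Real.sqrt (2 * d * c₁ / c₀) * (102 * (d + 1) ^ 2 * L * εU))) +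
              (2 * (256 * d * ((L : ℝ) - 1) ^ 2 / (M₀ : ℝ) ^ 2 * (c₁ / (c₀ * (L : ℝ) ^ d))) +
                8 * (Mφ' * Mφ * Real.sqrt (2 * d * c₁ / c₀) * (102 * (d + 1) ^ 2 * L * εU)) ^ 2)))) * ‖A‖ ^ 2 ≤
      (‖covCurlL2K ℂ c₀ ((η : ℂ))⁻¹ R A‖ ^ 2 + ‖covDivL2K ℂ c₀ ((η : ℂ))⁻¹ S A‖ ^ 2 +
          ‖((Real.sqrt a : ℝ) : ℂ) • QtorusW L m hL φ U hα1 hU1 hreg (c₁ := c₁) A‖ ^ 2) - ‖Wop A‖ ^ 2 := by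
  have h := ims_assembly_strong_lattice L m hL U hα1 hU1 hreg φ hεU hUε hMφ hφ hMφ' hφ' hM hdiv h2N χB χP χ0 χC hχB hχP hχ0 hχC hη hMT hR hS'
    ha Wop hWrow (γ₁ := 0) (γ₀ := γ₀) zero_le_one (fun z A => by simpa using hloc z A) A
  simpa using h

end Literature.MathematicalPhysics.QuantumFieldTheory.Balaban1983to89.B9Eq387IMSAssemblyLattice

end
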